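import Literature.MathematicalPhysics.QuantumFieldTheory.WilsonFinTorusPartition
import Literature.MathematicalPhysics.QuantumLattice.GaugeGroups
import HarnessLib

/-!
# The Wilson partition function of the `Fin`-indexed four-torus at COMPLEX coupling

Companion of `WilsonFinTorusPartition.lean`.  The items of route `ComplexCouplingChannel` of
`QuantumFields/YangMills` (stmt-QuantumFields-18841…18844) write INLINE the Wilson partition function of the
periodic box `a × a × a × t` at a complex coupling `z`,

  `Z_r(z; n₀,n₁,n₂,n₃) = ∫ exp(−z · Σ_x Σ_{μ<ν} (N − Re tr ρ(U_{x,μν}))) ∏_{links} dHaar`,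

an entire function of `z` (Fisher zeros, Lee–Yang / Penrose–Lebowitz analyticity arguments live at complex
coupling).  This file names that object, `wilsonFinTorusPartitionC ρ z n₀ n₁ n₂ n₃ : ℂ`, so that the items'
`let Zc := fun z a t => …` is `fun z a t => wilsonFinTorusPartitionC r.ρ z a a a t` by `rfl`
(`wilsonFinTorusPartitionC_eq_inline`), and proves the basic facts every user needs:

* `wilsonFinTorusPartitionC_ofReal` — at a real coupling it is the real partition function
  `wilsonFinTorusPartition` of `WilsonFinTorusPartition.lean` (hence, for equal sides, the tree's
  `partitionFunction` of `wilsonMeasure`, `partitionFunction_eq_ofReal_wilsonFinTorusPartition`);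
* `wilsonFinTorusPartitionC_zero` — `Z(0) = 1` (product of normalised Haar measures);
* `norm_wilsonFinTorusPartitionC_le` — `‖Z(z)‖ ≤ Z(Re z)`;
* `differentiable_wilsonFinTorusPartitionC` — `Z` is entire (continuous `ρ`, second-countable `G`:
  differentiation under the integral sign, the action being bounded and continuous on the compact
  configuration space).

References: M. E. Fisher, in *Lectures in Theoretical Physics* VII C (1965) (zeros in the complex
temperature/coupling plane); C. Itzykson, R. Pearson, J.-B. Zuber, Nucl. Phys. B 220 (1983) 415 (§2, Fisher
zeros of lattice models incl. gauge theories); I. Montvay, G. Münster, *Quantum Fields on a Lattice* (1994)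
§3.2.6 (3.145) (the Wilson partition function).
-/

noncomputable section

open scoped BigOperators Topology
open MeasureTheory Filter Function Complex Metric

namespace Literature.MathematicalPhysics.QuantumFieldTheory

variable {G : Type*} [Group G] {n : ℕ}

variable (ρ : G →* Matrix (Fin n) (Fin n) ℂ) [TopologicalSpace G] [IsTopologicalGroup G] [CompactSpace G]
  [MeasurableSpace G] [BorelSpace G]

/-- The Wilson action of the `Fin`-indexed anisotropic four-torus `n₀ × n₁ × n₂ × n₃` in the representation
`ρ`: `S(U) = Σ_x Σ_{μ<ν} (N − Re tr ρ(U_{x,μν}))` (the exponent of `wilsonFinTorusPartition` at `β = 1`).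
[cite: Wilson1974] -/
def finTorusWilsonAction {n₀ n₁ n₂ n₃ : ℕ} (U : FinTorusSite n₀ n₁ n₂ n₃ × Fin 4 → G) : ℝ :=
  ∑ x : FinTorusSite n₀ n₁ n₂ n₃, ∑ q : {q : Fin 4 × Fin 4 // q.1 < q.2},
    ((n : ℝ) - (ρ (finTorusPlaquette U x q.1.1 q.1.2)).trace.re)

/-- **The Wilson partition function of the four-torus `n₀ × n₁ × n₂ × n₃` at complex coupling `z`**:
`Z_{ρ}(z; n₀,n₁,n₂,n₃) = ∫ exp(−z S(U)) ∏_{(x,μ)} dHaar(U_{x,μ})`, `S` the Wilson action `finTorusWilsonAction`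
(product of normalised Haar measures over the positively oriented links).  Syntactically the `let Zc` of the
`ComplexCouplingChannel` route items (`wilsonFinTorusPartitionC_eq_inline`); at real `z` it is
`wilsonFinTorusPartition` (`wilsonFinTorusPartitionC_ofReal`).
[cite: ItzyksonPearsonZuber1983, §2 (partition function at complex coupling, Fisher zeros)] -/
def wilsonFinTorusPartitionC (z : ℂ) (n₀ n₁ n₂ n₃ : ℕ) : ℂ :=
  ∫ U, Complex.exp (-(z * ((finTorusWilsonAction ρ U : ℝ) : ℂ)))
    ∂(Measure.pi fun _ : FinTorusSite n₀ n₁ n₂ n₃ × Fin 4 => haarProbability G)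

/-- **The route items' inline complex partition function is `wilsonFinTorusPartitionC`** (definitional
unfolding, stated with the items' `let`-bound spelling of sites, shifts and plaquettes for sides `a, a, a, t`).
[folklore] -/
theorem wilsonFinTorusPartitionC_eq_inline (z : ℂ) (a t : ℕ) :
    wilsonFinTorusPartitionC ρ z a a a t =
      (let St := Fin a × Fin a × Fin a × Fin t
       let sh : St → Fin 4 → St := fun x μ => ![(finRotate a x.1, x.2.1, x.2.2.1, x.2.2.2),
         (x.1, finRotate a x.2.1, x.2.2.1, x.2.2.2), (x.1, x.2.1, finRotate a x.2.2.1, x.2.2.2),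
         (x.1, x.2.1, x.2.2.1, finRotate t x.2.2.2)] μ
       let pl : (St × Fin 4 → G) → St → Fin 4 → Fin 4 → G := fun U x μ ν =>
         U (x, μ) * U (sh x μ, ν) * (U (sh x ν, μ))⁻¹ * (U (x, ν))⁻¹
       ∫ U, Complex.exp (-(z * ((∑ x : St, ∑ q : {q : Fin 4 × Fin 4 // q.1 < q.2},
           ((n : ℝ) - (ρ (pl U x q.1.1 q.1.2)).trace.re) : ℝ) : ℂ)))
         ∂(Measure.pi fun _ : St × Fin 4 => haarProbability G)) :=
  rfl

/-- **At real coupling the complex partition function is the real one**: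
`Z(β; n₀,n₁,n₂,n₃) = wilsonFinTorusPartition ρ β n₀ n₁ n₂ n₃` for `β : ℝ`. [folklore] -/
theorem wilsonFinTorusPartitionC_ofReal (β : ℝ) (n₀ n₁ n₂ n₃ : ℕ) :
    wilsonFinTorusPartitionC ρ (β : ℂ) n₀ n₁ n₂ n₃ = ((wilsonFinTorusPartition ρ β n₀ n₁ n₂ n₃ : ℝ) : ℂ) := by
  unfold wilsonFinTorusPartitionC wilsonFinTorusPartition finTorusWilsonAction
  rw [← integral_complex_ofReal]
  refine integral_congr_ae (Eventually.of_forall fun U => ?_)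
  simp only [ofReal_exp]
  congr 1
  push_cast
  ring

/-- **`Z(0) = 1`**: at zero coupling the Wilson weight is `1` and the product Haar measure is a
probability measure. [folklore] -/
theorem wilsonFinTorusPartitionC_zero (n₀ n₁ n₂ n₃ : ℕ) : wilsonFinTorusPartitionC ρ 0 n₀ n₁ n₂ n₃ = 1 := by
  unfold wilsonFinTorusPartitionC
  simp

/-- **`‖Z(z)‖ ≤ Z(Re z)`**: the modulus of the complex partition function is at most the real partition
function at the real part of the coupling (`‖e^{−zS}‖ = e^{−(Re z) S}`). [folklore] -/
theorem norm_wilsonFinTorusPartitionC_le (z : ℂ) (n₀ n₁ n₂ n₃ : ℕ) :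
    ‖wilsonFinTorusPartitionC ρ z n₀ n₁ n₂ n₃‖ ≤ wilsonFinTorusPartition ρ z.re n₀ n₁ n₂ n₃ := by
  unfold wilsonFinTorusPartitionC wilsonFinTorusPartition
  refine (norm_integral_le_integral_norm _).trans (le_of_eq ?_)
  refine integral_congr_ae (Eventually.of_forall fun U => ?_)
  simp only [norm_exp, neg_re, mul_re, ofReal_re, ofReal_im, mul_zero, sub_zero, finTorusWilsonAction]
  ring_nf

omit [CompactSpace G] [MeasurableSpace G] [BorelSpace G] in
/-- The Wilson action of the `Fin`-torus is continuous in the configuration (continuous `ρ`). [folklore] -/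
theorem continuous_finTorusWilsonAction (hρ : Continuous ρ) {n₀ n₁ n₂ n₃ : ℕ} :
    Continuous (finTorusWilsonAction (n₀ := n₀) (n₁ := n₁) (n₂ := n₂) (n₃ := n₃) ρ) := by
  have hU : ∀ l : FinTorusSite n₀ n₁ n₂ n₃ × Fin 4,
      Continuous fun U : FinTorusSite n₀ n₁ n₂ n₃ × Fin 4 → G => U l := fun l => continuous_apply l
  have hpl : ∀ (x : FinTorusSite n₀ n₁ n₂ n₃) (μ ν : Fin 4),
      Continuous fun U : FinTorusSite n₀ n₁ n₂ n₃ × Fin 4 → G => finTorusPlaquette U x μ ν := fun x μ ν =>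
    (((hU _).mul (hU _)).mul (hU _).inv).mul (hU _).inv
  have htr : Continuous fun g : G => (ρ g).trace.re := Complex.continuous_re.comp (Continuous.matrix_trace hρ)
  unfold finTorusWilsonAction
  exact continuous_finsetSum _ fun x _ => continuous_finsetSum _ fun q _ =>
    continuous_const.sub (htr.comp (hpl x _ _))

omit [CompactSpace G] [MeasurableSpace G] [BorelSpace G] in
/-- The Wilson action of the `Fin`-torus is bounded: `|S(U)| ≤ B` for one `B` (finitely many plaquettes,
`|Re tr ρ(g)|` bounded on the compact group — here crudely via compactness of the configuration space).
[folklore] -/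
theorem exists_abs_finTorusWilsonAction_le [CompactSpace G] (hρ : Continuous ρ) (n₀ n₁ n₂ n₃ : ℕ) :
    ∃ B : ℝ, ∀ U : FinTorusSite n₀ n₁ n₂ n₃ × Fin 4 → G, |finTorusWilsonAction ρ U| ≤ B := by
  obtain ⟨B, hB⟩ := (isCompact_univ.image
    (continuous_abs.comp (continuous_finTorusWilsonAction ρ hρ))).isBounded.bddAbove
  exact ⟨B, fun U => hB ⟨U, Set.mem_univ _, rfl⟩⟩

variable [SecondCountableTopology G]

/-- **The complex partition function is entire** (continuous `ρ`, second-countable `G`): `z ↦ Z(z; n₀,…,n₃)` is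
complex differentiable on `ℂ`, with derivative `−∫ S e^{−zS}` (differentiation under the integral sign: the
integrand `e^{−zS(U)}` is entire in `z` with derivative bounded by `B e^{(‖z₀‖+1)B}` on `ball z₀ 1`, `|S| ≤ B`,
against a probability measure). [cite: ItzyksonPearsonZuber1983, §2] -/
theorem differentiable_wilsonFinTorusPartitionC (hρ : Continuous ρ) (n₀ n₁ n₂ n₃ : ℕ) :
    Differentiable ℂ fun z => wilsonFinTorusPartitionC ρ z n₀ n₁ n₂ n₃ := by
  intro z₀
  obtain ⟨B, hB⟩ := exists_abs_finTorusWilsonAction_le ρ hρ n₀ n₁ n₂ n₃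
  have hB0 : 0 ≤ B := (abs_nonneg _).trans (hB (fun _ => 1))
  set μ : Measure (FinTorusSite n₀ n₁ n₂ n₃ × Fin 4 → G) := Measure.pi fun _ => haarProbability G with hμ
  haveI : IsFiniteMeasure μ := by rw [hμ]; infer_instance
  set S : (FinTorusSite n₀ n₁ n₂ n₃ × Fin 4 → G) → ℝ := finTorusWilsonAction ρ with hS
  have hSc : Continuous S := continuous_finTorusWilsonAction ρ hρ
  set F : ℂ → (FinTorusSite n₀ n₁ n₂ n₃ × Fin 4 → G) → ℂ := fun z U => exp (-(z * (S U : ℂ))) with hF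
  set F' : ℂ → (FinTorusSite n₀ n₁ n₂ n₃ × Fin 4 → G) → ℂ := fun z U => -(S U : ℂ) * exp (-(z * (S U : ℂ)))
    with hF'
  have hFc : ∀ z, Continuous (F z) := fun z => by
    rw [hF]; exact Complex.continuous_exp.comp ((continuous_const.mul
      (continuous_ofReal.comp hSc)).neg)
  have hF'c : ∀ z, Continuous (F' z) := fun z => by
    rw [hF']; exact (continuous_ofReal.comp hSc).neg.mul (hFc z)
  -- pointwise bound on the derivative on `ball z₀ 1`
  have hbound : ∀ U, ∀ z ∈ ball z₀ 1, ‖F' z U‖ ≤ B * Real.exp ((‖z₀‖ + 1) * B) := by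
    intro U z hz
    have hzle : ‖z‖ ≤ ‖z₀‖ + 1 := by
      have := mem_ball_iff_norm.1 hz
      linarith [norm_le_norm_add_norm_sub' z z₀, norm_sub_rev z z₀]
    rw [hF']
    simp only [norm_mul, norm_neg, norm_real, Real.norm_eq_abs, norm_exp]
    refine mul_le_mul (hB U) (Real.exp_le_exp.2 ?_) (Real.exp_pos _).le hB0
    have h1 : (-(z * (S U : ℂ))).re ≤ ‖z * (S U : ℂ)‖ := by
      rw [neg_re]; exact (neg_le_abs _).trans (abs_re_le_norm _)
    refine h1.trans ?_
    rw [norm_mul, norm_real, Real.norm_eq_abs]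
    exact mul_le_mul hzle (hB U) (abs_nonneg _) (by positivity)
  have key := hasDerivAt_integral_of_dominated_loc_of_deriv_le (μ := μ) (F := F) (F' := F') (x₀ := z₀)
    (s := ball z₀ 1) (bound := fun _ => B * Real.exp ((‖z₀‖ + 1) * B)) (ball_mem_nhds z₀ one_pos)
    (Eventually.of_forall fun z => (hFc z).aestronglyMeasurable)
    ((hFc z₀).integrable_of_hasCompactSupport
      (IsCompact.of_isClosed_subset isCompact_univ (isClosed_tsupport _) (Set.subset_univ _)))
    (hF'c z₀).aestronglyMeasurable (Eventually.of_forall hbound) (integrable_const _)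
    (Eventually.of_forall fun U z _ => by
      rw [hF, hF']
      have h := ((hasDerivAt_id z).mul_const (S U : ℂ)).neg.cexp
      simpa [mul_comm] using h)
  exact key.2.differentiableAt

end Literature.MathematicalPhysics.QuantumFieldTheory

end
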